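import Summits.CriticalPhenomena.PercolationContinuityZ3.Theorems.PercNearOneGluingNoHeavyPcintMemUniformTenData
import HarnessLib

/-!
# CriticalPhenomena/PercolationContinuityZ3 — Theorems/PercNearOneGluingNoHeavyPcintMemUniformTenStructA.lean: fast structural check of rows 0–1535 of the memory-10 list (kernel)

Lane prim-pcint, STRUCTURE rule (prim-pcint-2 GEN 19).  `URowsOKF u10tab 10 6192 lo 192 = true` for the 192-row ranges of rows 0–1535, each by one
`decide +kernel` (tuple-model check of …MemUniformChunkFast: every recorded successor is `mstep 10` of the row state up to the recorded
symmetry, indices `< 6192`), assembled as `structRows10A : URowsOKC perm6 u10tab 10 6192 0 1536` by `urowsOKC_of_fast` + `permsOK_perm6`.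
Generated by numerics/emit_u10struct.py.

HONEST FRAMING: kernel evaluation of a finite check.  No `sorry`; standard axioms.  Written by prim-pcint-2 gen 19, 2026-08-26.
-/

namespace Summit.CriticalPhenomena.PercolationContinuityZ3.Theorems.Pcint

open Literature.Probability.Percolation Literature.Probability.LatticeModels

/-- Fast structural check of rows 0–191. [folklore] -/
theorem struct10_0 : URowsOKF u10tab 10 6192 0 192 = true := by
  decide +kernel

/-- Fast structural check of rows 192–383. [folklore] -/
theorem struct10_1 : URowsOKF u10tab 10 6192 192 192 = true := by
  decide +kernel

/-- Fast structural check of rows 384–575. [folklore] -/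
theorem struct10_2 : URowsOKF u10tab 10 6192 384 192 = true := by
  decide +kernel

/-- Fast structural check of rows 576–767. [folklore] -/
theorem struct10_3 : URowsOKF u10tab 10 6192 576 192 = true := by
  decide +kernel

/-- Fast structural check of rows 768–959. [folklore] -/
theorem struct10_4 : URowsOKF u10tab 10 6192 768 192 = true := by
  decide +kernel

/-- Fast structural check of rows 960–1151. [folklore] -/
theorem struct10_5 : URowsOKF u10tab 10 6192 960 192 = true := by
  decide +kernel

/-- Fast structural check of rows 1152–1343. [folklore] -/
theorem struct10_6 : URowsOKF u10tab 10 6192 1152 192 = true := by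
  decide +kernel

/-- Fast structural check of rows 1344–1535. [folklore] -/
theorem struct10_7 : URowsOKF u10tab 10 6192 1344 192 = true := by
  decide +kernel

/-- **Rows 0–1535 of the memory-10 list are structurally valid.** [folklore] -/
theorem structRows10A : URowsOKC perm6 u10tab 10 6192 0 1536 :=
  (urowsOKC_append perm6 u10tab (urowsOKC_append perm6 u10tab (urowsOKC_append perm6 u10tab (urowsOKC_append perm6 u10tab (urowsOKC_append perm6 u10tab (urowsOKC_append perm6 u10tab (urowsOKC_append perm6 u10tab (urowsOKC_of_fast u10tab permsOK_perm6 struct10_0) (urowsOKC_of_fast u10tab permsOK_perm6 struct10_1)) (urowsOKC_of_fast u10tab permsOK_perm6 struct10_2)) (urowsOKC_of_fast u10tab permsOK_perm6 struct10_3)) (urowsOKC_of_fast u10tab permsOK_perm6 struct10_4)) (urowsOKC_of_fast u10tab permsOK_perm6 struct10_5)) (urowsOKC_of_fast u10tab permsOK_perm6 struct10_6)) (urowsOKC_of_fast u10tab permsOK_perm6 struct10_7))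

end Summit.CriticalPhenomena.PercolationContinuityZ3.Theorems.Pcint
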